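import Mathlib
import HarnessLib
import Summits.FinalStateConjecture.Statement
import Summits.FinalStateConjecture.FinalStateConjecture.Theses.SwallowTheDatum
import Literature.Geometry.Lorentzian.InitialDataPullback
import Literature.Geometry.Lorentzian.KerrData

/-!
# Sketch — first lemmas for crux-ideate cards on `SwallowTheDatum.ParametricKerrBurial`
(planner-cruxidea-stmt-FinalStateConjecture-10052-2-0, round 1). Statements only (Props); nothing is proved here
except the trivial reparametrisation remark is left as a Prop too.

* `EventualConstancySmooth` — glue lemma (card A, C): a family that is jointly smooth off `c = 0` and locally
  eventually constant at `c = 0` is an `IsSmoothDataFamily`.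
* `RecedingSchwarzschildGluing` — card A first lemma: Mao–Oh–Tao obstruction-free far-annulus gluing of an
  admissible datum to ONE fixed exact isotropic Schwarzschild seed, at every large radius, smoothly in the radius.
* `UniversalCollarDatum` — card C first lemma (also refined step (U) of card A): ONE admissible vacuum datum on `E3`
  which is exact isotropic Schwarzschild(μ) on `{1 < ‖x‖ < 2}` and Kerr-shielded with the crux's conjuncts verbatim;
  `UniversalCollarFamily` — optional `μ`-family version, jointly smooth in `(μ, x)`.
* `RecedingSchwarzschildGluingGrowing`, `TransferRefined` — growing-seed variant and the refined architecture.
* `ShieldedExhaustion` and `Transfer` — the architecture: radius-indexed shielded data agreeing with `d` off the far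
  region, smooth in the radius, imply the crux.
-/

open scoped Manifold ContDiff Topology
open Bundle Set Filter Literature.Geometry.Lorentzian

noncomputable section

namespace Summit.FinalStateConjecture.FinalStateConjecture.Cruxes.ParametricKerrBurial.IdeaSketch

/-- Glue lemma (cards A and C). If `F : ℝ¹ → InitialDataSet` is jointly smooth on `{c ≠ 0} × X` and every point of
`X` has a neighbourhood on which `F c = F 0` for all small `c` ("local eventual constancy"), then `F` is a smooth
one-parameter family in the typed sense. Pure differential topology (`ContMDiff` is local; near `(0, x₀)` the map
is `(c, x) ↦ F 0 x`). -/
def EventualConstancySmooth : Prop :=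
  ∀ (X : Type) [TopologicalSpace X] [ChartedSpace E3 X] [IsManifold (𝓡 3) ((⊤ : ℕ∞) : WithTop ℕ∞) X]
    (F : EuclideanSpace ℝ (Fin 1) → InitialDataSet (𝓡 3) X),
    ContMDiffOn (𝓘(ℝ, EuclideanSpace ℝ (Fin 1)).prod (𝓡 3)) ((𝓡 3).prod 𝓘(ℝ, E3 →L[ℝ] E3 →L[ℝ] ℝ)) ∞
        (fun p : EuclideanSpace ℝ (Fin 1) × X ↦
          TotalSpace.mk' (F := E3 →L[ℝ] E3 →L[ℝ] ℝ)
            (E := fun x : X ↦ TangentSpace (𝓡 3) x →L[ℝ] TangentSpace (𝓡 3) x →L[ℝ] ℝ) p.2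
            ((F p.1).h.inner p.2)) {p | p.1 ≠ 0} →
    ContMDiffOn (𝓘(ℝ, EuclideanSpace ℝ (Fin 1)).prod (𝓡 3)) ((𝓡 3).prod 𝓘(ℝ, E3 →L[ℝ] E3 →L[ℝ] ℝ)) ∞
        (fun p : EuclideanSpace ℝ (Fin 1) × X ↦
          TotalSpace.mk' (F := E3 →L[ℝ] E3 →L[ℝ] ℝ)
            (E := fun x : X ↦ TangentSpace (𝓡 3) x →L[ℝ] TangentSpace (𝓡 3) x →L[ℝ] ℝ) p.2
            ((F p.1).k p.2)) {p | p.1 ≠ 0} →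
    (∀ x₀ : X, ∃ V ∈ 𝓝 x₀, ∃ ε > (0 : ℝ), ∀ c : EuclideanSpace ℝ (Fin 1), ‖c‖ < ε →
        ∀ x ∈ V, (F c).h.inner x = (F 0).h.inner x ∧ (F c).k x = (F 0).k x) →
    InitialDataSet.IsSmoothDataFamily 1 F

/-- Card A, first lemma (Mao–Oh–Tao, arXiv:2308.13031, Thm 1.10 with `(g_out, k_out)` = the time-symmetric
isotropic Schwarzschild slice of ONE fixed mass `M₀' > E_ADM(d) + |P_ADM(d)|`, upgraded to a family that is smooth in
the gluing radius). For every admissible datum `d` there are an end structure `e`, a seed mass `M₀'`, a threshold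
`Rstar` and a radius-indexed family `G` of ADMISSIBLE data such that for every `R > Rstar`: `G R = d` off the far region
`e.far R`, and in the chart of `e` the datum `G R` is EXACTLY isotropic Schwarzschild(`M₀'`)
(`h = (1 + M₀'/(2‖x‖))⁴ δ`, `k = 0`) on `{32 R < ‖x‖}`; moreover `(R, x) ↦ G R x` is jointly smooth on
`{Rstar < R} × X`. Only two derivatives of `h` and one of `k` with Dafermos–Rodnianski decay are used
(`s = 2 > 3/2`, `α = 1 > 1/2` in MOT's Def. 1.5), exactly what `admissibleVacuumData` provides. -/
def RecedingSchwarzschildGluing : Prop :=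
  ∀ (X : Type) [TopologicalSpace X] [ChartedSpace E3 X] [IsManifold (𝓡 3) ((⊤ : ℕ∞) : WithTop ℕ∞) X]
    [T2Space X] [SecondCountableTopology X] [ConnectedSpace X],
    ∀ d ∈ admissibleVacuumData X, ∃ (e : AFEnd X) (M₀' Rstar : ℝ) (G : ℝ → InitialDataSet (𝓡 3) X),
      e.R < Rstar ∧ 0 < M₀' ∧
      ContMDiffOn (𝓘(ℝ, ℝ).prod (𝓡 3)) ((𝓡 3).prod 𝓘(ℝ, E3 →L[ℝ] E3 →L[ℝ] ℝ)) ∞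
        (fun p : ℝ × X ↦
          TotalSpace.mk' (F := E3 →L[ℝ] E3 →L[ℝ] ℝ)
            (E := fun x : X ↦ TangentSpace (𝓡 3) x →L[ℝ] TangentSpace (𝓡 3) x →L[ℝ] ℝ) p.2
            ((G p.1).h.inner p.2)) {p | Rstar < p.1} ∧
      ContMDiffOn (𝓘(ℝ, ℝ).prod (𝓡 3)) ((𝓡 3).prod 𝓘(ℝ, E3 →L[ℝ] E3 →L[ℝ] ℝ)) ∞
        (fun p : ℝ × X ↦
          TotalSpace.mk' (F := E3 →L[ℝ] E3 →L[ℝ] ℝ)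
            (E := fun x : X ↦ TangentSpace (𝓡 3) x →L[ℝ] TangentSpace (𝓡 3) x →L[ℝ] ℝ) p.2
            ((G p.1).k p.2)) {p | Rstar < p.1} ∧
      ∀ R, Rstar < R →
        G R ∈ admissibleVacuumData X ∧
        (∀ x ∉ e.far R, (G R).h.inner x = d.h.inner x ∧ (G R).k x = d.k x) ∧
        (∀ x : E3, 32 * R < ‖x‖ →
          AFEnd.hCoeff e (G R) x = (1 + M₀' / (2 * ‖x‖)) ^ 4 • (innerSL ℝ : E3 →L[ℝ] E3 →L[ℝ] ℝ) ∧
          AFEnd.kCoeff e (G R) x = 0)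

/-- Optional strengthening of `UniversalCollarDatum` (cards A, C): the UNIVERSAL COLLAR FAMILY. There are
`μ₀ > 0` and a family `C μ` of ADMISSIBLE data on `E3` (complete, one DR-asymptotically-flat end, vacuum), jointly
smooth in `(μ, x)`, such that for `0 < μ ≤ μ₀`: on `{1 < ‖x‖ < 2}` the datum `C μ` is EXACTLY the time-symmetric
isotropic Schwarzschild(`μ`) datum, and `C μ` is Kerr-shielded with the crux's conjuncts verbatim (mass normalised to
`[1/2, 2]`). What sits inside the unit ball is an arbitrary vacuum filler (e.g. a rescaled Corvino core); only
`{1 < ‖x‖}` is used downstream. Not needed by the refined architecture (`TransferRefined`); kept as the fallback if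
the growing-seed step fails. -/
def UniversalCollarFamily : Prop :=
  ∀ [Kerr.Facts], ∃ (μ₀ : ℝ) (C : ℝ → InitialDataSet (𝓡 3) E3), 0 < μ₀ ∧
    ContMDiffOn (𝓘(ℝ, ℝ).prod (𝓡 3)) ((𝓡 3).prod 𝓘(ℝ, E3 →L[ℝ] E3 →L[ℝ] ℝ)) ∞
        (fun p : ℝ × E3 ↦
          TotalSpace.mk' (F := E3 →L[ℝ] E3 →L[ℝ] ℝ)
            (E := fun x : E3 ↦ TangentSpace (𝓡 3) x →L[ℝ] TangentSpace (𝓡 3) x →L[ℝ] ℝ) p.2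
            ((C p.1).h.inner p.2)) {p | p.1 < μ₀ + 1} ∧
    ContMDiffOn (𝓘(ℝ, ℝ).prod (𝓡 3)) ((𝓡 3).prod 𝓘(ℝ, E3 →L[ℝ] E3 →L[ℝ] ℝ)) ∞
        (fun p : ℝ × E3 ↦
          TotalSpace.mk' (F := E3 →L[ℝ] E3 →L[ℝ] ℝ)
            (E := fun x : E3 ↦ TangentSpace (𝓡 3) x →L[ℝ] TangentSpace (𝓡 3) x →L[ℝ] ℝ) p.2
            ((C p.1).k p.2)) {p | p.1 < μ₀ + 1} ∧
    ∀ μ, 0 < μ → μ ≤ μ₀ →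
      C μ ∈ admissibleVacuumData E3 ∧
      (∀ y : E3, 1 < ‖y‖ → ‖y‖ < 2 →
        (C μ).h.inner y = (1 + μ / (2 * ‖y‖)) ^ 4 • (innerSL ℝ : E3 →L[ℝ] E3 →L[ℝ] ℝ) ∧ (C μ).k y = 0) ∧
      ∃ (M a r₁ : ℝ) (hM : 0 ≤ M) (T : ℝ → ℝ) (φ : Kerr.slice a r₁ → E3)
        (ψ : Kerr.slice a r₁ → Kerr.region a r₁) (ν : NormalField 𝓘(ℝ, E4) ψ),
        1 / 2 ≤ M ∧ M ≤ 2 ∧ |a| < M ∧ Kerr.rMinus M a < r₁ ∧ r₁ < Kerr.rPlus M a ∧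
        T = (fun r : ℝ => Real.smoothTransition (r / (4 * M) - 1) *
          (((M) / Real.sqrt ((M) ^ 2 - (a) ^ 2)) *
              (Kerr.rPlus M a * Real.log (r - Kerr.rPlus M a) - Kerr.rMinus M a * Real.log (r - Kerr.rMinus M a)) -
            ((M) / Real.sqrt ((M) ^ 2 - (a) ^ 2)) *
              (Kerr.rPlus M a * Real.log ((4 * M) - Kerr.rPlus M a) -
                Kerr.rMinus M a * Real.log ((4 * M) - Kerr.rMinus M a)))) ∧
        IsCompact (Set.range φ)ᶜ ∧ Topology.IsOpenEmbedding φ ∧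
        ContMDiff 𝓘(ℝ, E3) (𝓡 3) ((⊤ : ℕ∞) : WithTop ℕ∞) φ ∧
        (∀ y : Kerr.slice a r₁, (ψ y : E4) =
          E4.ofTimeSpace (T (Kerr.radius a (E4.ofTimeSpace 0 (y : E3)))) (y : E3)) ∧
        (Kerr.smoothMetric M a r₁).IsSpacelikeImmersion 𝓘(ℝ, E3) ψ ∧
        (Kerr.smoothMetric M a r₁).IsFutureUnitNormal 𝓘(ℝ, E3)
          ((Kerr.timeOrientation M a r₁ hM).ofLE le_top) ψ ν ∧
        (∀ y : Kerr.slice a r₁,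
          pullbackBilin (I := 𝓡 3) (I' := 𝓘(ℝ, E3)) φ (C μ).h.inner y =
            pullbackBilin (I := 𝓘(ℝ, E4)) (I' := 𝓘(ℝ, E3)) ψ (Kerr.smoothMetric M a r₁).val y) ∧
        (∀ [(Kerr.smoothMetric M a r₁).HasLeviCivita] (y : Kerr.slice a r₁),
          (pullbackBilin (I := 𝓡 3) (I' := 𝓘(ℝ, E3)) φ (C μ).k y).toLinearMap₁₂ =
            (Kerr.smoothMetric M a r₁).secondFundamentalForm 𝓘(ℝ, E3) ψ ν y)

/-- The architecture shared by cards A and C (the `Transfer` form C⁺ of the crux): for every admissible `d`, a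
RADIUS-indexed family of admissible, Kerr-shielded data which agree with `d` off the far region `e.far R` and
depend smoothly on `R` — no statement about `R → ∞` convergence is needed. -/
def ShieldedExhaustion : Prop :=
  ∀ [Kerr.Facts] (X : Type) [TopologicalSpace X] [ChartedSpace E3 X] [IsManifold (𝓡 3) ((⊤ : ℕ∞) : WithTop ℕ∞) X]
    [T2Space X] [SecondCountableTopology X] [ConnectedSpace X],
    ∀ d ∈ admissibleVacuumData X, ∃ (e : AFEnd X) (Rstar : ℝ) (Mof : ℝ → ℝ) (G : ℝ → InitialDataSet (𝓡 3) X),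
      e.R < Rstar ∧ StrictMonoOn Mof (Set.Ioi Rstar) ∧
      ContMDiffOn (𝓘(ℝ, ℝ).prod (𝓡 3)) ((𝓡 3).prod 𝓘(ℝ, E3 →L[ℝ] E3 →L[ℝ] ℝ)) ∞
        (fun p : ℝ × X ↦
          TotalSpace.mk' (F := E3 →L[ℝ] E3 →L[ℝ] ℝ)
            (E := fun x : X ↦ TangentSpace (𝓡 3) x →L[ℝ] TangentSpace (𝓡 3) x →L[ℝ] ℝ) p.2
            ((G p.1).h.inner p.2)) {p | Rstar < p.1} ∧
      ContMDiffOn (𝓘(ℝ, ℝ).prod (𝓡 3)) ((𝓡 3).prod 𝓘(ℝ, E3 →L[ℝ] E3 →L[ℝ] ℝ)) ∞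
        (fun p : ℝ × X ↦
          TotalSpace.mk' (F := E3 →L[ℝ] E3 →L[ℝ] ℝ)
            (E := fun x : X ↦ TangentSpace (𝓡 3) x →L[ℝ] TangentSpace (𝓡 3) x →L[ℝ] ℝ) p.2
            ((G p.1).k p.2)) {p | Rstar < p.1} ∧
      ∀ R, Rstar < R →
        G R ∈ admissibleVacuumData X ∧
        (∀ x ∉ e.far R, (G R).h.inner x = d.h.inner x ∧ (G R).k x = d.k x) ∧
        -- the mass read off at infinity in the fixed chart of `e` is `Mof R` (injectivity certificate):
        Tendsto (fun s : ℝ ↦ s * (AFEnd.hCoeff e (G R) (EuclideanSpace.single 0 s)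
          (EuclideanSpace.single 0 1) (EuclideanSpace.single 0 1) - 1)) atTop (𝓝 (2 * Mof R)) ∧
        -- Kerr-shielded, verbatim the crux's conjuncts:
        ∃ (M a r₁ : ℝ) (hM : 0 ≤ M) (T : ℝ → ℝ) (φ : Kerr.slice a r₁ → X)
          (ψ : Kerr.slice a r₁ → Kerr.region a r₁) (ν : NormalField 𝓘(ℝ, E4) ψ),
          |a| < M ∧ Kerr.rMinus M a < r₁ ∧ r₁ < Kerr.rPlus M a ∧
          T = (fun r : ℝ => Real.smoothTransition (r / (4 * M) - 1) *
            (((M) / Real.sqrt ((M) ^ 2 - (a) ^ 2)) *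
                (Kerr.rPlus M a * Real.log (r - Kerr.rPlus M a) -
                  Kerr.rMinus M a * Real.log (r - Kerr.rMinus M a)) -
              ((M) / Real.sqrt ((M) ^ 2 - (a) ^ 2)) *
                (Kerr.rPlus M a * Real.log ((4 * M) - Kerr.rPlus M a) -
                  Kerr.rMinus M a * Real.log ((4 * M) - Kerr.rMinus M a)))) ∧
          IsCompact (Set.range φ)ᶜ ∧ Topology.IsOpenEmbedding φ ∧
          ContMDiff 𝓘(ℝ, E3) (𝓡 3) ((⊤ : ℕ∞) : WithTop ℕ∞) φ ∧
          (∀ y : Kerr.slice a r₁, (ψ y : E4) =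
            E4.ofTimeSpace (T (Kerr.radius a (E4.ofTimeSpace 0 (y : E3)))) (y : E3)) ∧
          (Kerr.smoothMetric M a r₁).IsSpacelikeImmersion 𝓘(ℝ, E3) ψ ∧
          (Kerr.smoothMetric M a r₁).IsFutureUnitNormal 𝓘(ℝ, E3)
            ((Kerr.timeOrientation M a r₁ hM).ofLE le_top) ψ ν ∧
          (∀ y : Kerr.slice a r₁,
            pullbackBilin (I := 𝓡 3) (I' := 𝓘(ℝ, E3)) φ (G R).h.inner y =
              pullbackBilin (I := 𝓘(ℝ, E4)) (I' := 𝓘(ℝ, E3)) ψ (Kerr.smoothMetric M a r₁).val y) ∧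
          (∀ [(Kerr.smoothMetric M a r₁).HasLeviCivita] (y : Kerr.slice a r₁),
            (pullbackBilin (I := 𝓡 3) (I' := 𝓘(ℝ, E3)) φ (G R).k y).toLinearMap₁₂ =
              (Kerr.smoothMetric M a r₁).secondFundamentalForm 𝓘(ℝ, E3) ψ ν y)

/-- TRANSFER (cards A, C): radius-indexed shielded exhaustion plus the eventual-constancy glue lemma give the crux
(reparametrise `R = Rstar + 1 + 1/c²`; injectivity from `Mof` strictly monotone and `F 0 = d` having mass
`M_d < Mof R` eventually, or by the at-most-one-bad-parameter reparametrisation). Logic + elementary analysis. -/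
def Transfer : Prop :=
  EventualConstancySmooth → ShieldedExhaustion →
    Summit.FinalStateConjecture.FinalStateConjecture.Theses.SwallowTheDatum.ParametricKerrBurial


/-- Card A, first lemma — GROWING-SEED variant (the one the refined architecture uses): as
`RecedingSchwarzschildGluing`, but the exact isotropic Schwarzschild seed outside `{32 R < ‖x‖}` has mass `η R`
growing linearly with the gluing radius, for some fixed `η > 0` (chosen below Mao–Oh–Tao's unit-scale thresholds
`ε_o², μ_o` of Thm 1.7: at scale `R` the charge gap is `ΔE ≈ η`, small but NOT tending to zero — Thm 1.7 asks no
more). With this variant ONE universal collar datum (`UniversalCollarDatum`) rescaled by `M(c) = 32 R(c)/ρ₀`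
finishes the burial; no `μ → 0` family is needed. -/
def RecedingSchwarzschildGluingGrowing : Prop :=
  ∀ (X : Type) [TopologicalSpace X] [ChartedSpace E3 X] [IsManifold (𝓡 3) ((⊤ : ℕ∞) : WithTop ℕ∞) X]
    [T2Space X] [SecondCountableTopology X] [ConnectedSpace X],
    ∃ η₀ : ℝ, 0 < η₀ ∧ ∀ η, 0 < η → η ≤ η₀ →
    ∀ d ∈ admissibleVacuumData X, ∃ (e : AFEnd X) (Rstar : ℝ) (G : ℝ → InitialDataSet (𝓡 3) X),
      e.R < Rstar ∧
      ContMDiffOn (𝓘(ℝ, ℝ).prod (𝓡 3)) ((𝓡 3).prod 𝓘(ℝ, E3 →L[ℝ] E3 →L[ℝ] ℝ)) ∞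
        (fun p : ℝ × X ↦
          TotalSpace.mk' (F := E3 →L[ℝ] E3 →L[ℝ] ℝ)
            (E := fun x : X ↦ TangentSpace (𝓡 3) x →L[ℝ] TangentSpace (𝓡 3) x →L[ℝ] ℝ) p.2
            ((G p.1).h.inner p.2)) {p | Rstar < p.1} ∧
      ContMDiffOn (𝓘(ℝ, ℝ).prod (𝓡 3)) ((𝓡 3).prod 𝓘(ℝ, E3 →L[ℝ] E3 →L[ℝ] ℝ)) ∞
        (fun p : ℝ × X ↦
          TotalSpace.mk' (F := E3 →L[ℝ] E3 →L[ℝ] ℝ)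
            (E := fun x : X ↦ TangentSpace (𝓡 3) x →L[ℝ] TangentSpace (𝓡 3) x →L[ℝ] ℝ) p.2
            ((G p.1).k p.2)) {p | Rstar < p.1} ∧
      ∀ R, Rstar < R →
        G R ∈ admissibleVacuumData X ∧
        (∀ x ∉ e.far R, (G R).h.inner x = d.h.inner x ∧ (G R).k x = d.k x) ∧
        (∀ x : E3, 32 * R < ‖x‖ →
          AFEnd.hCoeff e (G R) x = (1 + η * R / (2 * ‖x‖)) ^ 4 • (innerSL ℝ : E3 →L[ℝ] E3 →L[ℝ] ℝ) ∧
          AFEnd.kCoeff e (G R) x = 0)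

/-- ONE UNIVERSAL COLLAR DATUM (refined step (U) of cards A and C; card C's first lemma). For every small seed
mass `μ` there is a single ADMISSIBLE vacuum datum on `E3` (complete, one DR-asymptotically-flat end) which is
EXACTLY the time-symmetric isotropic Schwarzschild(`μ`) datum on the annulus `{1 < ‖x‖ < 2}` and is Kerr-shielded with
the crux's conjuncts VERBATIM (compact complement of the shielding chart's range; shield mass normalised to
`[1/2, 2]`). No parameter dependence is asserted. The filler inside the unit ball is any vacuum core (rescaled
Corvino core, or the seeded construction's own interior); downstream only `{1 < ‖x‖}` is used, rescaled by `M(c)`. -/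
def UniversalCollarDatum : Prop :=
  ∀ [Kerr.Facts], ∃ μ₀ : ℝ, 0 < μ₀ ∧ ∀ μ, 0 < μ → μ ≤ μ₀ →
    ∃ C ∈ admissibleVacuumData E3,
      (∀ y : E3, 1 < ‖y‖ → ‖y‖ < 2 →
        C.h.inner y = (1 + μ / (2 * ‖y‖)) ^ 4 • (innerSL ℝ : E3 →L[ℝ] E3 →L[ℝ] ℝ) ∧ C.k y = 0) ∧
      ∃ (M a r₁ : ℝ) (hM : 0 ≤ M) (T : ℝ → ℝ) (φ : Kerr.slice a r₁ → E3)
        (ψ : Kerr.slice a r₁ → Kerr.region a r₁) (ν : NormalField 𝓘(ℝ, E4) ψ),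
        1 / 2 ≤ M ∧ M ≤ 2 ∧ |a| < M ∧ Kerr.rMinus M a < r₁ ∧ r₁ < Kerr.rPlus M a ∧
        T = (fun r : ℝ => Real.smoothTransition (r / (4 * M) - 1) *
          (((M) / Real.sqrt ((M) ^ 2 - (a) ^ 2)) *
              (Kerr.rPlus M a * Real.log (r - Kerr.rPlus M a) - Kerr.rMinus M a * Real.log (r - Kerr.rMinus M a)) -
            ((M) / Real.sqrt ((M) ^ 2 - (a) ^ 2)) *
              (Kerr.rPlus M a * Real.log ((4 * M) - Kerr.rPlus M a) -
                Kerr.rMinus M a * Real.log ((4 * M) - Kerr.rMinus M a)))) ∧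
        IsCompact (Set.range φ)ᶜ ∧ Topology.IsOpenEmbedding φ ∧
        ContMDiff 𝓘(ℝ, E3) (𝓡 3) ((⊤ : ℕ∞) : WithTop ℕ∞) φ ∧
        (∀ y : Kerr.slice a r₁, (ψ y : E4) =
          E4.ofTimeSpace (T (Kerr.radius a (E4.ofTimeSpace 0 (y : E3)))) (y : E3)) ∧
        (Kerr.smoothMetric M a r₁).IsSpacelikeImmersion 𝓘(ℝ, E3) ψ ∧
        (Kerr.smoothMetric M a r₁).IsFutureUnitNormal 𝓘(ℝ, E3)
          ((Kerr.timeOrientation M a r₁ hM).ofLE le_top) ψ ν ∧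
        (∀ y : Kerr.slice a r₁,
          pullbackBilin (I := 𝓡 3) (I' := 𝓘(ℝ, E3)) φ C.h.inner y =
            pullbackBilin (I := 𝓘(ℝ, E4)) (I' := 𝓘(ℝ, E3)) ψ (Kerr.smoothMetric M a r₁).val y) ∧
        (∀ [(Kerr.smoothMetric M a r₁).HasLeviCivita] (y : Kerr.slice a r₁),
          (pullbackBilin (I := 𝓡 3) (I' := 𝓘(ℝ, E3)) φ C.k y).toLinearMap₁₂ =
            (Kerr.smoothMetric M a r₁).secondFundamentalForm 𝓘(ℝ, E3) ψ ν y)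

/-- Refined TRANSFER (cards A, C): growing-seed far-annulus gluing + one universal collar datum + the
eventual-constancy glue lemma give the crux: `F c := [G (R(c))` on `X` with its `{32 R(c) < ‖x‖}` end replaced by
`M(c) · (collar datum)`, `M(c) = 32 R(c)/ρ₀`, `R(c) = Rstar + 1 + 1/c²`]; agreement of the two exact isotropic
Schwarzschild(`η R(c)`) pieces on `{32R(c) < ‖x‖ < 64 R(c)}` makes the union a smooth vacuum datum; smooth in
`c ≠ 0` by smoothness in `R` and of scaling; smooth at `0` by eventual constancy; injective by the mass `∝ R(c)`
read at infinity. Logic + calculus + the patching lemma for data agreeing on an open overlap. -/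
def TransferRefined : Prop :=
  EventualConstancySmooth → RecedingSchwarzschildGluingGrowing → UniversalCollarDatum →
    Summit.FinalStateConjecture.FinalStateConjecture.Theses.SwallowTheDatum.ParametricKerrBurial

end Summit.FinalStateConjecture.FinalStateConjecture.Cruxes.ParametricKerrBurial.IdeaSketch

end
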